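/-
Copyright (c) 2026 The HCML crux team. All rights reserved.
Released under Apache 2.0 license as described in the file LICENSE.
Authors: K2E3-p14 (g5) (explicit-unit `hodgecm-mathlib-K2E3-p14-g5`)
-/
import Summits.HodgeConjecture.HodgeConjecture.Theorems.K2E3GLnAdHeightBalls     -- ★ (B4-0 file 1) p857992 (this seat): the balls `𝔅_m`, `adBall_iff_of_coe_eq_diagonal`
import HarnessLib

/-!
# (GL-[M6]-sc, VOL-split brick V0) The Ad-height of `u · a` and `a · u` for `u` unipotent and `a` diagonal

Cell `hodgecm-mathlib`, Track B, line `K2_E3_EllipticInputs`; payer «GL-[M6]-sc» of leaf (11-3-split-sc-NE) (dealer K2E3-plan (g3) D63, line lead K2E3-p23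
(g5), RULINGS #11 (M11-1), BLUEPRINT v4 §2 «VOL-split»).  In Harish-Chandra's volume count for the split torus [HarishChandra1970, Part VII §3 pp. 71–73]
the Haar measure of `{z = k·n·a : 𝔅_{R'}(z) ∧ 𝔅_m(z t z⁻¹)}` is computed in Iwasawa coordinates; the two elementary readings of the scale-invariant
Ad-height balls `𝔅_m(g) :≡ ∀ i j k l, |ϖ^m g_{ij} (g⁻¹)_{kl}| ≤ 1` (★ B4-0) that make the torus variable and the unipotent variable separate are:
* **the unipotent entries are read off `𝔅`**: if `u` has unit diagonal (and so has `u⁻¹`) and `a = diag(α)`, then `𝔅_ρ(u · a)` or `𝔅_ρ(a · u)` forces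
  `|ϖ^ρ u_{ij}| ≤ 1` for ALL `i, j` (`v_pow_mul_apply_le_one_of_adBall_mul_diagonal`, `…_of_adBall_diagonal_mul`: take the index quadruple `(i, j, j, j)`,
  resp. `(i, j, i, i)`, where the diagonal factor cancels) — so `{n : 𝔅_m(n γ)}` lies in the `N`-box of radius `m`, whatever the diagonal `γ`;
* **the torus part is read off `𝔅`**: `𝔅_ρ(u · a) ⇒ 𝔅_ρ(a)` and `𝔅_ρ(a · u) ⇒ 𝔅_ρ(a)` (`adBall_diagonal_of_adBall_unipotent_mul`, `…_mul_unipotent`: the quadruples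
  `(j, j, k, k)` give `|ϖ^ρ α_j ∕ α_k| ≤ 1`, which is `𝔅_ρ(diag α)` by ★ `adBall_iff_of_coe_eq_diagonal`) — so in `z = k n a` the range of `a` is the height ball
  of radius `R'` of the torus, independently of `n`.
Pure algebra over any field with `Valued K ℤᵐ⁰` and any finite index type; constructor-agnostic (`↑a = diagonal α`, unit-diagonal hypotheses on `u`, `u⁻¹`).

HONEST LABEL: HC_CM is proved only modulo the 7 printed citations (2 remaining named inputs: hLiu418 = stmt-HodgeConjecture-24832, h413 =
stmt-HodgeConjecture-24833) until rung 0 closes; count-neutral (kernel lane `--supports stmt-HodgeConjecture-24833 --as helper`), THEOREMS ONLY — no `def`, no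
instance, no notation, no `sorry`.
References: Harish-Chandra (van Dijk), *Harmonic Analysis on Reductive p-adic Groups*, LNM 162 (1970), Part VII §2 p. 69, §3 pp. 71–73
[cite: HarishChandra1970, Part VII §3 p. 72]; P. Cartier, PSPM 33.1 (1979) §IV.1 [cite: Cartier1979, §IV.1].
-/

open Set Function
open scoped MatrixGroups WithZero
open Matrix
open Summit.HodgeConjecture.HodgeConjecture.Cruxes.H413.K2E3GLnAdHeightBalls

set_option linter.dupNamespace false

noncomputable section

namespace Summit.HodgeConjecture.HodgeConjecture.Cruxes.H413.K2E3GLnUnipotentAdHeight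

variable {K : Type*} [Field K] {n : Type*} [Fintype n] [DecidableEq n]

/-- The diagonal entries of an invertible diagonal matrix are non-zero. [folklore] -/
theorem ne_zero_of_coe_eq_diagonal {a : GL n K} {α : n → K} (ha : (a : Matrix n n K) = Matrix.diagonal α) (j : n) : α j ≠ 0 := by
  intro h0
  have h1 : ((a * a⁻¹ : GL n K) : Matrix n n K) j j = 1 := by rw [mul_inv_cancel, Units.val_one, Matrix.one_apply_eq]
  rw [Units.val_mul, ha, Matrix.diagonal_mul, h0, zero_mul] at h1
  exact zero_ne_one h1

/-- Entries of `u · a`, `a = diag(α)`: `(u a)_{ij} = u_{ij} α_j`. [folklore] -/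
theorem coe_mul_apply_of_coe_eq_diagonal (u : GL n K) {a : GL n K} {α : n → K} (ha : (a : Matrix n n K) = Matrix.diagonal α) (i j : n) :
    ((u * a : GL n K) : Matrix n n K) i j = (u : Matrix n n K) i j * α j := by
  rw [Units.val_mul, ha, Matrix.mul_diagonal]

/-- Entries of `(u · a)⁻¹ = a⁻¹ u⁻¹`, `a = diag(α)`: `((u a)⁻¹)_{kl} = α_k⁻¹ (u⁻¹)_{kl}`. [folklore] -/
theorem coe_mul_inv_apply_of_coe_eq_diagonal (u : GL n K) {a : GL n K} {α : n → K} (ha : (a : Matrix n n K) = Matrix.diagonal α) (k l : n) :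
    (((u * a)⁻¹ : GL n K) : Matrix n n K) k l = (α k)⁻¹ * ((u⁻¹ : GL n K) : Matrix n n K) k l := by
  rw [_root_.mul_inv_rev, Units.val_mul, coe_inv_eq_diagonal_inv ha, Matrix.diagonal_mul]

/-- Entries of `a · u`, `a = diag(α)`: `(a u)_{ij} = α_i u_{ij}`. [folklore] -/
theorem coe_diagonal_mul_apply_of_coe_eq_diagonal {a : GL n K} {α : n → K} (ha : (a : Matrix n n K) = Matrix.diagonal α) (u : GL n K) (i j : n) :
    ((a * u : GL n K) : Matrix n n K) i j = α i * (u : Matrix n n K) i j := by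
  rw [Units.val_mul, ha, Matrix.diagonal_mul]

/-- Entries of `(a · u)⁻¹ = u⁻¹ a⁻¹`, `a = diag(α)`: `((a u)⁻¹)_{kl} = (u⁻¹)_{kl} α_l⁻¹`. [folklore] -/
theorem coe_diagonal_mul_inv_apply_of_coe_eq_diagonal {a : GL n K} {α : n → K} (ha : (a : Matrix n n K) = Matrix.diagonal α) (u : GL n K) (k l : n) :
    (((a * u)⁻¹ : GL n K) : Matrix n n K) k l = ((u⁻¹ : GL n K) : Matrix n n K) k l * (α l)⁻¹ := by
  rw [_root_.mul_inv_rev, Units.val_mul, coe_inv_eq_diagonal_inv ha, Matrix.mul_diagonal]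

variable [Valued K ℤᵐ⁰]

/-- **THE UNIPOTENT ENTRIES ARE READ OFF `𝔅_ρ(u · a)`**: for `u` with unit diagonal INVERSE (`(u⁻¹)_{jj} = 1`) and `a = diag(α)`,
`𝔅_ρ(u a) ⇒ |ϖ^ρ u_{ij}| ≤ 1` for all `i, j` (quadruple `(i,j,j,j)`: `(ua)_{ij} ((ua)⁻¹)_{jj} = u_{ij} α_j · α_j⁻¹ = u_{ij}`).  In particular
`{n ∈ N : 𝔅_m(n γ)}` lies in the `N`-box of radius `m` for every diagonal `γ`. [cite: HarishChandra1970, Part VII §3 p. 72] -/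
theorem v_pow_mul_apply_le_one_of_adBall_mul_diagonal {ϖ : K} {ρ : ℕ} {u a : GL n K} {α : n → K} (ha : (a : Matrix n n K) = Matrix.diagonal α)
    (hu' : ∀ j, ((u⁻¹ : GL n K) : Matrix n n K) j j = 1)
    (h : ∀ i j k l, Valued.v (ϖ ^ ρ * (((u * a : GL n K) : Matrix n n K) i j * (((u * a)⁻¹ : GL n K) : Matrix n n K) k l)) ≤ 1) (i j : n) :
    Valued.v (ϖ ^ ρ * (u : Matrix n n K) i j) ≤ 1 := by
  have h1 := h i j j j
  rwa [coe_mul_apply_of_coe_eq_diagonal u ha, coe_mul_inv_apply_of_coe_eq_diagonal u ha, hu', mul_one, mul_assoc,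
    mul_inv_cancel₀ (ne_zero_of_coe_eq_diagonal ha j), mul_one] at h1

/-- **THE UNIPOTENT ENTRIES ARE READ OFF `𝔅_ρ(a · u)`**: for `u` with unit diagonal inverse and `a = diag(α)`, `𝔅_ρ(a u) ⇒ |ϖ^ρ u_{ij}| ≤ 1` for all `i, j`
(quadruple `(i,j,i,i)`: `(au)_{ij} ((au)⁻¹)_{ii} = α_i u_{ij} · α_i⁻¹`). [cite: HarishChandra1970, Part VII §3 p. 72] -/
theorem v_pow_mul_apply_le_one_of_adBall_diagonal_mul {ϖ : K} {ρ : ℕ} {u a : GL n K} {α : n → K} (ha : (a : Matrix n n K) = Matrix.diagonal α)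
    (hu' : ∀ i, ((u⁻¹ : GL n K) : Matrix n n K) i i = 1)
    (h : ∀ i j k l, Valued.v (ϖ ^ ρ * (((a * u : GL n K) : Matrix n n K) i j * (((a * u)⁻¹ : GL n K) : Matrix n n K) k l)) ≤ 1) (i j : n) :
    Valued.v (ϖ ^ ρ * (u : Matrix n n K) i j) ≤ 1 := by
  have h1 := h i j i i
  rwa [coe_diagonal_mul_apply_of_coe_eq_diagonal ha u, coe_diagonal_mul_inv_apply_of_coe_eq_diagonal ha u, hu', one_mul, mul_assoc, mul_comm (α i),
    mul_assoc, inv_mul_cancel₀ (ne_zero_of_coe_eq_diagonal ha i), mul_one] at h1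

/-- **THE TORUS PART IS READ OFF `𝔅_ρ(u · a)`**: for `u` with unit diagonal and unit-diagonal inverse and `a = diag(α)`, `𝔅_ρ(u a) ⇒ 𝔅_ρ(a)`
(quadruples `(j,j,k,k)`: `(ua)_{jj} ((ua)⁻¹)_{kk} = α_j α_k⁻¹`, then ★ `adBall_iff_of_coe_eq_diagonal`).  In `z = k n a` the torus variable ranges in the height
ball of radius `R'` of `A`, independently of `n`. [cite: HarishChandra1970, Part VII §3 p. 72] -/
theorem adBall_diagonal_of_adBall_unipotent_mul {ϖ : K} {ρ : ℕ} {u a : GL n K} {α : n → K} (ha : (a : Matrix n n K) = Matrix.diagonal α)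
    (hu : ∀ j, (u : Matrix n n K) j j = 1) (hu' : ∀ k, ((u⁻¹ : GL n K) : Matrix n n K) k k = 1)
    (h : ∀ i j k l, Valued.v (ϖ ^ ρ * (((u * a : GL n K) : Matrix n n K) i j * (((u * a)⁻¹ : GL n K) : Matrix n n K) k l)) ≤ 1) :
    ∀ i j k l, Valued.v (ϖ ^ ρ * ((a : Matrix n n K) i j * ((a⁻¹ : GL n K) : Matrix n n K) k l)) ≤ 1 := by
  refine (adBall_iff_of_coe_eq_diagonal ϖ ρ ha).2 fun j k => ?_
  have h1 := h j j k k
  rwa [coe_mul_apply_of_coe_eq_diagonal u ha, coe_mul_inv_apply_of_coe_eq_diagonal u ha, hu, hu', one_mul, mul_one] at h1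

/-- **THE TORUS PART IS READ OFF `𝔅_ρ(a · u)`**: `𝔅_ρ(a u) ⇒ 𝔅_ρ(a)` for `u` with unit diagonal and unit-diagonal inverse, `a = diag(α)`.
[cite: HarishChandra1970, Part VII §3 p. 72] -/
theorem adBall_diagonal_of_adBall_mul_unipotent {ϖ : K} {ρ : ℕ} {u a : GL n K} {α : n → K} (ha : (a : Matrix n n K) = Matrix.diagonal α)
    (hu : ∀ j, (u : Matrix n n K) j j = 1) (hu' : ∀ k, ((u⁻¹ : GL n K) : Matrix n n K) k k = 1)
    (h : ∀ i j k l, Valued.v (ϖ ^ ρ * (((a * u : GL n K) : Matrix n n K) i j * (((a * u)⁻¹ : GL n K) : Matrix n n K) k l)) ≤ 1) :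
    ∀ i j k l, Valued.v (ϖ ^ ρ * ((a : Matrix n n K) i j * ((a⁻¹ : GL n K) : Matrix n n K) k l)) ≤ 1 := by
  refine (adBall_iff_of_coe_eq_diagonal ϖ ρ ha).2 fun j k => ?_
  have h1 := h j j k k
  rwa [coe_diagonal_mul_apply_of_coe_eq_diagonal ha u, coe_diagonal_mul_inv_apply_of_coe_eq_diagonal ha u, hu, hu', one_mul, mul_one] at h1

/-- **`𝔅_ρ(u a)` also bounds the INVERSE unipotent entries**: `|ϖ^ρ (u⁻¹)_{kl}| ≤ 1` (quadruple `(k,k,k,l)`: `(ua)_{kk} ((ua)⁻¹)_{kl} = α_k · α_k⁻¹ (u⁻¹)_{kl}`).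
[cite: HarishChandra1970, Part VII §3 p. 72] -/
theorem v_pow_mul_inv_apply_le_one_of_adBall_mul_diagonal {ϖ : K} {ρ : ℕ} {u a : GL n K} {α : n → K} (ha : (a : Matrix n n K) = Matrix.diagonal α)
    (hu : ∀ k, (u : Matrix n n K) k k = 1)
    (h : ∀ i j k l, Valued.v (ϖ ^ ρ * (((u * a : GL n K) : Matrix n n K) i j * (((u * a)⁻¹ : GL n K) : Matrix n n K) k l)) ≤ 1) (k l : n) :
    Valued.v (ϖ ^ ρ * ((u⁻¹ : GL n K) : Matrix n n K) k l) ≤ 1 := by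
  have h1 := h k k k l
  rwa [coe_mul_apply_of_coe_eq_diagonal u ha, coe_mul_inv_apply_of_coe_eq_diagonal u ha, hu, one_mul, ← mul_assoc (α k),
    mul_inv_cancel₀ (ne_zero_of_coe_eq_diagonal ha k), one_mul] at h1

/-- Conversely, **an `N`-box is inside a height ball**: if all entries of `u` AND of `u⁻¹` satisfy `|ϖ^ρ ·| ≤ 1` then `𝔅_{ρ+ρ}(u)` (★ B4-0 `adBall` at `m = 0`
is `GL_n(𝒪)`; this is its scaled form, by the same one-line product bound). [cite: HarishChandra1970, Part VII §2 p. 69] -/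
theorem adBall_of_forall_v_pow_mul_apply_le_one (ϖ : K) {ρ : ℕ} {u : GL n K} (hu : ∀ i j, Valued.v (ϖ ^ ρ * (u : Matrix n n K) i j) ≤ 1)
    (hu' : ∀ k l, Valued.v (ϖ ^ ρ * ((u⁻¹ : GL n K) : Matrix n n K) k l) ≤ 1) :
    ∀ i j k l, Valued.v (ϖ ^ (ρ + ρ) * ((u : Matrix n n K) i j * ((u⁻¹ : GL n K) : Matrix n n K) k l)) ≤ 1 := by
  intro i j k l
  have heq : ϖ ^ (ρ + ρ) * ((u : Matrix n n K) i j * ((u⁻¹ : GL n K) : Matrix n n K) k l) =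
      (ϖ ^ ρ * (u : Matrix n n K) i j) * (ϖ ^ ρ * ((u⁻¹ : GL n K) : Matrix n n K) k l) := by ring
  rw [heq, map_mul]
  exact mul_le_one' (hu i j) (hu' k l)

end Summit.HodgeConjecture.HodgeConjecture.Cruxes.H413.K2E3GLnUnipotentAdHeight

end
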